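import Mathlib
import HarnessLib
import Literature.Analysis.Approximation.TrigonometricPolynomialZeroDensity

/-!
# Route `WeakCouplingBCS` — certificate half of stmt-HubbardSuperconductivity-0158, item «(E2)-TPRIME-LINDHARD-BOUND» (pen (R460)(A)), towards (N2) = (SV):
# the ONE-DIMENSIONAL SLICE BRICKS of the chart-free shell-volume route (scope memo `HOME/prover-p4/E2-TPRIME-LINDHARD-SCOPE.md` §8)

Cell `gate-hubbard-kl`, seat p4 (g23); zero kit; pure real analysis, no definitions.  For the `t`–`t′` band `ε_{t′}(x, y) = −2cos x − A(x)·cos y`,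
`A(x) = 2 + 4t′cos x`, every slice `x = const` of the energy shell `{|ε − μ| < t}` is a cosine-sublevel set `{y : |cos y − g(x)| < t/A(x)}`; this file bounds the
length of such a set:
* `volume_abs_cos_sub_lt_inter_Ioc_le` — `λ({y ∈ (−π, π] : |cos y − g| < τ}) ≤ 2·(arccos (g − τ) − arccos (g + τ))` (Mathlib's `arccos` clamps outside `[−1, 1]`);
* `sqrt_one_sub_sq_mul_ge` — the algebraic heart `(1 + a)(1 − b) ≤ √((1 − a²)(1 − b²))` for `−1 ≤ a ≤ b ≤ 1`;
* `arccos_sub_arccos_le_arccos_one_sub` — the MODULUS OF CONTINUITY of `arccos`: `arccos a − arccos b ≤ arccos (1 − (b − a))` for `−1 ≤ a ≤ b ≤ 1` (sharp: equality at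
  the endpoint pairs), hence `arccos_sub_arccos_le_two_sqrt`: `≤ 2·√(b − a)` when `b − a ≤ 1` (by `Literature…arccos_one_sub_lt`) — the crude ½-Hölder slice bound;
* `arccos_sub_arccos_le_div_sqrt` — the Lipschitz bound off the ends: `arccos a − arccos b ≤ (b − a)/√(1 − m²)` for `−m ≤ a ≤ b ≤ m`, `0 ≤ m < 1` (mean value theorem
  with `deriv arccos = −1/√(1 − x²)`) — the `τ/√u` slice bound of memo §8 (ii).
Nothing here asserts (SV) for any band, a record, a margin, `K₃`, `U₀`, the window or superconductivity.  [folklore]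
-/

noncomputable section

-- the tree's namespace `Summit.<Summit>.<Problem>.Theorems` repeats the summit name by design (D-0017)
set_option linter.dupNamespace false

namespace Summit.HubbardSuperconductivity.HubbardSuperconductivity.Theorems

open Real Set MeasureTheory
open scoped ENNReal

/-! ### §1 The length of a cosine-sublevel slice -/

/-- **`λ({y ∈ (−π, π] : |cos y − g| < τ}) ≤ 2·(arccos (g − τ) − arccos (g + τ))`**: on `[0, π]` the set lies in `[arccos (g + τ), arccos (g − τ)]` (`arccos` is
antitone and `arccos (cos y) = y`), and `y ↦ −y` maps the `[−π, 0)` half into the mirror interval. [folklore] -/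
theorem volume_abs_cos_sub_lt_inter_Ioc_le (g τ : ℝ) :
    volume ({y : ℝ | |cos y - g| < τ} ∩ Ioc (-π) π) ≤ ENNReal.ofReal (2 * (arccos (g - τ) - arccos (g + τ))) := by
  rcases le_or_gt τ 0 with hτ | hτ
  · have hempty : {y : ℝ | |cos y - g| < τ} ∩ Ioc (-π) π = ∅ := by
      ext y
      simp only [mem_inter_iff, mem_setOf_eq, mem_empty_iff_false, iff_false, not_and]
      intro h; exact absurd (h.trans_le hτ) (not_lt.2 (abs_nonneg _))
    rw [hempty, measure_empty]; exact bot_le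
  set a : ℝ := arccos (g + τ) with ha
  set b : ℝ := arccos (g - τ) with hb
  have hsub : {y : ℝ | |cos y - g| < τ} ∩ Ioc (-π) π ⊆ Icc a b ∪ Icc (-b) (-a) := by
    rintro y ⟨hy, hyI⟩
    rw [mem_setOf_eq, abs_lt] at hy
    obtain ⟨h1, h2⟩ := hy
    have hc1 : g - τ ≤ cos y := by linarith
    have hc2 : cos y ≤ g + τ := by linarith
    rcases le_or_gt 0 y with hy0 | hy0
    · left
      have hyc : arccos (cos y) = y := arccos_cos hy0 hyI.2
      refine ⟨?_, ?_⟩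
      · rw [ha, ← hyc]; exact arccos_le_arccos hc2
      · rw [hb, ← hyc]; exact arccos_le_arccos hc1
    · right
      have hyc : arccos (cos (-y)) = -y := arccos_cos (by linarith) (by linarith [hyI.1])
      rw [cos_neg] at hyc
      refine ⟨?_, ?_⟩
      · rw [hb, neg_le, ← hyc]; exact arccos_le_arccos hc1
      · rw [ha, le_neg, ← hyc]; exact arccos_le_arccos hc2
  have hab : a ≤ b := by rw [ha, hb]; exact arccos_le_arccos (by linarith)
  calc volume ({y : ℝ | |cos y - g| < τ} ∩ Ioc (-π) π) ≤ volume (Icc a b ∪ Icc (-b) (-a)) := measure_mono hsub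
    _ ≤ volume (Icc a b) + volume (Icc (-b) (-a)) := measure_union_le _ _
    _ = ENNReal.ofReal (b - a) + ENNReal.ofReal (-a - -b) := by rw [Real.volume_Icc, Real.volume_Icc]
    _ = ENNReal.ofReal (2 * (b - a)) := by
        rw [← ENNReal.ofReal_add (by linarith) (by linarith)]; congr 1; ring

/-! ### §2 The modulus of continuity of `arccos` -/

/-- The algebraic heart: `(1 + a)(1 − b) ≤ √((1 − a²)(1 − b²))` for `−1 ≤ a ≤ b ≤ 1` (since `(1 − a)(1 + b) ≥ (1 + a)(1 − b)`). [folklore] -/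
theorem sqrt_one_sub_sq_mul_ge {a b : ℝ} (ha : -1 ≤ a) (hab : a ≤ b) (hb : b ≤ 1) :
    (1 + a) * (1 - b) ≤ Real.sqrt ((1 - a ^ 2) * (1 - b ^ 2)) := by
  have h0 : 0 ≤ (1 + a) * (1 - b) := mul_nonneg (by linarith) (by linarith)
  have hle : ((1 + a) * (1 - b)) ^ 2 ≤ (1 - a ^ 2) * (1 - b ^ 2) := by
    have h1 : (1 - a ^ 2) * (1 - b ^ 2) = ((1 + a) * (1 - b)) * ((1 - a) * (1 + b)) := by ring
    have h2 : (1 + a) * (1 - b) ≤ (1 - a) * (1 + b) := by nlinarith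
    rw [h1, sq]
    exact mul_le_mul_of_nonneg_left h2 h0
  calc (1 + a) * (1 - b) = Real.sqrt (((1 + a) * (1 - b)) ^ 2) := (Real.sqrt_sq h0).symm
    _ ≤ Real.sqrt ((1 - a ^ 2) * (1 - b ^ 2)) := Real.sqrt_le_sqrt hle

/-- **The modulus of continuity of `arccos`**: `arccos a − arccos b ≤ arccos (1 − (b − a))` for `−1 ≤ a ≤ b ≤ 1` (equality at `b = 1` and at `a = −1`):
`cos (arccos a − arccos b) = ab + √(1−a²)√(1−b²) ≥ ab + (1 + a)(1 − b) = 1 − (b − a)`. [folklore] -/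
theorem arccos_sub_arccos_le_arccos_one_sub {a b : ℝ} (ha : -1 ≤ a) (hab : a ≤ b) (hb : b ≤ 1) :
    arccos a - arccos b ≤ arccos (1 - (b - a)) := by
  have hb' : -1 ≤ b := ha.trans hab
  have ha' : a ≤ 1 := hab.trans hb
  have hd0 : 0 ≤ arccos a - arccos b := sub_nonneg.2 (arccos_le_arccos hab)
  have hdπ : arccos a - arccos b ≤ π := by linarith [arccos_le_pi a, arccos_nonneg b]
  have hcos : 1 - (b - a) ≤ cos (arccos a - arccos b) := by
    rw [cos_sub, cos_arccos ha ha', cos_arccos hb' hb, sin_arccos, sin_arccos, ← Real.sqrt_mul (by nlinarith)]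
    have h1 := sqrt_one_sub_sq_mul_ge ha hab hb
    have h2 : (1 + a) * (1 - b) = 1 - (b - a) - a * b := by ring
    linarith
  calc arccos a - arccos b = arccos (cos (arccos a - arccos b)) := (arccos_cos hd0 hdπ).symm
    _ ≤ arccos (1 - (b - a)) := arccos_le_arccos hcos

/-- **The crude ½-Hölder bound**: `arccos a − arccos b ≤ 2·√(b − a)` for `−1 ≤ a ≤ b ≤ 1` with `b − a ≤ 1` (`Literature…arccos_one_sub_lt`). [folklore] -/
theorem arccos_sub_arccos_le_two_sqrt {a b : ℝ} (ha : -1 ≤ a) (hab : a ≤ b) (hb : b ≤ 1) (hd : b - a ≤ 1) :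
    arccos a - arccos b ≤ 2 * Real.sqrt (b - a) := by
  rcases eq_or_lt_of_le hab with heq | hlt
  · rw [heq, sub_self, sub_self, Real.sqrt_zero, mul_zero]
  · exact (arccos_sub_arccos_le_arccos_one_sub ha hab hb).trans
      (Literature.Analysis.Approximation.TrigonometricPolynomialZeroDensity.arccos_one_sub_lt (sub_pos.2 hlt) hd).le

/-! ### §3 The Lipschitz bound off the ends -/

/-- **`arccos a − arccos b ≤ (b − a)/√(1 − m²)`** for `−m ≤ a ≤ b ≤ m`, `0 ≤ m < 1` (mean value theorem; `deriv arccos = −1/√(1 − x²)`, and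
`√(1 − x²) ≥ √(1 − m²)` on `[−m, m]`). [folklore] -/
theorem arccos_sub_arccos_le_div_sqrt {a b m : ℝ} (hm0 : 0 ≤ m) (hm1 : m < 1) (ha : -m ≤ a) (hab : a ≤ b) (hb : b ≤ m) :
    arccos a - arccos b ≤ (b - a) / Real.sqrt (1 - m ^ 2) := by
  have hm2 : 0 < 1 - m ^ 2 := by nlinarith
  have hsq0 : 0 < Real.sqrt (1 - m ^ 2) := Real.sqrt_pos.2 hm2
  set D : Set ℝ := Icc (-m) m with hD
  have hDc : Convex ℝ D := convex_Icc _ _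
  -- `f := −arccos` has derivative `1/√(1−x²) ≤ 1/√(1−m²)` on the interior `(−m, m)`
  have hf : ContinuousOn (fun x => -arccos x) D := continuous_arccos.neg.continuousOn
  have hint : interior D = Ioo (-m) m := by rw [hD, interior_Icc]
  have hne : ∀ x ∈ interior D, x ≠ -1 ∧ x ≠ 1 := fun x hx => by
    rw [hint] at hx; exact ⟨by linarith [hx.1], by linarith [hx.2]⟩
  have hf' : DifferentiableOn ℝ (fun x => -arccos x) (interior D) := fun x hx =>
    ((differentiableAt_arccos.2 (hne x hx)).neg).differentiableWithinAt
  have hderiv : ∀ x ∈ interior D, deriv (fun x => -arccos x) x ≤ 1 / Real.sqrt (1 - m ^ 2) := by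
    intro x hx
    have hx' := hne x hx
    rw [hint] at hx
    rw [deriv.fun_neg, deriv_arccos]
    simp only [neg_neg]
    have hxm : x ^ 2 ≤ m ^ 2 := by nlinarith [hx.1, hx.2]
    have hx2 : 0 < 1 - x ^ 2 := by linarith
    exact one_div_le_one_div_of_le hsq0 (Real.sqrt_le_sqrt (by linarith))
  have h := hDc.image_sub_le_mul_sub_of_deriv_le hf hf' hderiv a ⟨ha, hab.trans hb⟩ b ⟨ha.trans hab, hb⟩ hab
  have h' : arccos a - arccos b ≤ 1 / Real.sqrt (1 - m ^ 2) * (b - a) := by linarith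
  calc arccos a - arccos b ≤ 1 / Real.sqrt (1 - m ^ 2) * (b - a) := h'
    _ = (b - a) / Real.sqrt (1 - m ^ 2) := by rw [one_div, inv_mul_eq_div]

end Summit.HubbardSuperconductivity.HubbardSuperconductivity.Theorems

end
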